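import Literature.Probability.RandomPlanarGeometry.ChordalPathFill
import HarnessLib

/-!
# The asymmetry sentence of [LSW] Cor. 8.6 (`SLEKappaRho.one_half_lt_measure_I_notMem_fill`) is the Cor. 8.6 input transported along Thm. 8.4

Proof-only glue (no definition, no named fact) for the named fact
`Literature.Probability.RandomPlanarGeometry.SLEKappaRho.one_half_lt_measure_I_notMem_fill`
(`SLEKappaRho`: for `−2 < ρ < 0` and every SLE(8/3, ρ) driving pair,
`P{i ∉ F^{ℝ₊}_ℍ(cl K_∞)} > 1/2` — the first two sentences of the proof of Cor. 8.6), after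

* G. F. Lawler, O. Schramm, W. Werner, *Conformal restriction: the chordal case*, J. Amer. Math.
  Soc. **16** (2003) 917–955, arXiv:math/0209343 (**[LSW]**, arXiv page numbers), proof of
  Cor. 8.6 (p. 38): "Note that when `ρ < 0`, `W_t − √κ B_t` is decreasing. It follows easily
  that the probability that `i` ends up eventually to 'the right' of the right hand boundary of
  SLE(8/3, ρ) […] is strictly larger than the corresponding quantity for SLE(8/3, 0), which is
  `1/2` by symmetry."; Thm. 8.4 (p. 37); §8.1 (p. 31, uniqueness of `P⁺_α`); Prop. 4.1 (p. 16);
* G. F. Lawler, *Conformally Invariant Processes in the Plane*, AMS (2005) (**[Law05]**),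
  Cor. 9.11 (p. 219) and §9.2 Prop. 9.13 (p. 220).

Record of the split review (D-0026) of this fact, a decomposition child of the Cor. 8.6 input
`exists_isRightRestrictionMeasure_lt_five_eighths` (`OneSidedRestriction`: "for `0 < α < 5/8`,
`P⁺_α` exists and `P⁺_α{i ∉ K} > 1/2`"). PROVED here:

* `SLEKappaRho.one_half_lt_measure_I_notMem_fill_iff_of_fill` — **given [LSW] Thm. 8.4 in law
  form (`SLEKappaRho.isRightRestrictionMeasure_fill`), the child is EQUIVALENT to its parent**:
  `P{i ∉ F^{ℝ₊}_ℍ(cl K_∞)} = P⁺_{α(ρ)}{i ∉ K}` for the law `P⁺_{α(ρ)}` of the `Ω₊`-valued version,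
  `α(ρ)` sweeping `(0, 5/8)` as `ρ` sweeps `(−2, 0)`, and `P⁺_α` is unique (§8.1). So the child
  carries no content independent of the parent beyond Thm. 8.4; in particular it is not a step
  towards the parent, which the tree obtains WITHOUT SLE(8/3, ρ) from any two-sided `P_1`
  (`exists_isRightRestrictionMeasure_lt_five_eighths_of_exists_one`, [Law05] Cor. 9.11 with
  Prop. 9.13, file `OneSidedExcursionCloudInterior`);
* hence the child's discharge recipes over the tree's remaining deep leaves, all glue proved:
  `…_of_martingale_of_exists_one` (the one-sided restriction martingale of Lemmas 8.9–8.10,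
  `SLEKappaRho.exists_isOneSidedMartingale`, which gives Thm. 8.4 —
  `SLEKappaRho.isRightRestrictionMeasure_fill_of_martingale` — plus any `P_1`),
  `…_of_martingale_of_chordalPath` (the martingale plus [LSW] Prop. 4.1 in the hypothesis form
  of `ChordalPathFill`: a random path from `0` to `∞` in `ℍ` avoiding each `A ∈ 𝒬*` with
  probability `Φ'_A(0)`), `…_of_four_leaves` (the martingale plus the three existence-only §7
  leaves `exists_isBrownianBubbleMeasure`, `SLEBubbles.ae_mem_restrictionConfigs`,
  `SLEBubbles.lintegral_poissonAvoidance_eq_rpow`, through `P_1 = law of Ξ(2)`).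

Not attempted (and not needed for any statement of [LSW] in the tree): the literal route of
p. 38 through the strict comparison of the SLE(8/3, ρ) and SLE(8/3, 0) chains under the monotone
coupling `W ≤ √κ B` (`SLEKappaRho.measure_I_notMem_fill_lt_of_neg`, no proof printed; see
`RestrictionMeasuresFiveEighthsPositivity` for why its strictness is the small-exponent
positivity `P⁺_β{i ∈ K} > 0`).

Mathlib: `Real.rpow_one`. Tree: `SLEKappaRho.map_apply_setOf_I_notMem` (`SLEKappaRhoAsymmetry`),
`IsRightRestrictionMeasure.one_half_lt_measure_notMem_I_of_lt_five_eighths`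
(`OneSidedRestrictionFacts`), `exists_isRightRestrictionMeasure_lt_five_eighths_of_sleKappaRho`
(`SLEKappaRho`), `SLEKappaRho.isRightRestrictionMeasure_fill_of_martingale`
(`RestrictionMeasuresFiveEighthsProofs`), `exists_isRightRestrictionMeasure_lt_five_eighths_of_exists_one`,
`exists_isRestrictionMeasure_one_of_three_leaves` (`OneSidedExcursionCloudInterior`),
`exists_isRestrictionMeasure_of_chordalPath` (`ChordalPathFill`).

## References

* [LSW] proof of Cor. 8.6 (p. 38), Thm. 8.4 (p. 37), §8.1 (p. 31), Prop. 4.1 (p. 16), Thm. 7.3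
  (p. 29). [LawlerSchrammWerner2003Restriction]
* [Law05] Cor. 9.11 (p. 219), §9.2 Prop. 9.13 (p. 220). [Lawler2005]
-/

noncomputable section

open Set MeasureTheory
open UpperHalfPlane (upperHalfPlaneSet)
open scoped NNReal ENNReal
open Literature.Probability.Process (preWienerMeasure)

namespace Literature.Probability.RandomPlanarGeometry

/-! ### Given Thm. 8.4, the child is its parent transported along the law identification -/

/-- **The asymmetry of SLE(8/3, ρ), `ρ < 0`, from Thm. 8.4 and the Cor. 8.6 input**: if
`F^{ℝ₊}_ℍ(cl K_∞)` of SLE(8/3, ρ) has an `Ω₊`-valued version of law `P⁺_{α(ρ)}` (`h84`, [LSW]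
Thm. 8.4) and every `P⁺_α`, `0 < α < 5/8`, gives `{i ∉ K}` probability `> 1/2` (`h`, by the
uniqueness of `P⁺_α` the second conjunct of `exists_isRightRestrictionMeasure_lt_five_eighths`),
then `P{i ∉ F^{ℝ₊}_ℍ(cl K_∞)} = P⁺_{α(ρ)}{i ∉ K} > 1/2` for `−2 < ρ < 0` (`0 < α(ρ) < 5/8`).
[cite: LawlerSchrammWerner2003Restriction, proof of Cor. 8.6 (p. 38) with Thm. 8.4 (p. 37) and §8.1 (p. 31, uniqueness)] -/
theorem SLEKappaRho.one_half_lt_measure_I_notMem_fill_of_fill_of_lt_five_eighths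
    (h84 : SLEKappaRho.isRightRestrictionMeasure_fill)
    (h : exists_isRightRestrictionMeasure_lt_five_eighths) :
    SLEKappaRho.one_half_lt_measure_I_notMem_fill := by
  intro ρ O W hρ hρ0 hOW
  obtain ⟨Kc, hKc, hae, hQ⟩ := h84 hρ hOW
  rw [← SLEKappaRho.map_apply_setOf_I_notMem hKc hae]
  exact IsRightRestrictionMeasure.one_half_lt_measure_notMem_I_of_lt_five_eighths h hQ
    (sleKappaRhoExponent_pos hρ) ((sleKappaRhoExponent_lt_five_eighths_iff hρ).2 hρ0)

/-- **Given [LSW] Thm. 8.4 in law form, the asymmetry sentence of p. 38 for SLE(8/3, ρ) is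
EQUIVALENT to the Cor. 8.6 input `exists_isRightRestrictionMeasure_lt_five_eighths`** (the
forward direction is the assembly `exists_isRightRestrictionMeasure_lt_five_eighths_of_sleKappaRho`
of `SLEKappaRho`, the backward one the previous theorem).
[cite: LawlerSchrammWerner2003Restriction, proof of Cor. 8.6 (p. 38) with Thm. 8.4 (p. 37) and §8.1 (p. 31)] -/
theorem SLEKappaRho.one_half_lt_measure_I_notMem_fill_iff_of_fill
    (h84 : SLEKappaRho.isRightRestrictionMeasure_fill) :
    SLEKappaRho.one_half_lt_measure_I_notMem_fill ↔ exists_isRightRestrictionMeasure_lt_five_eighths :=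
  ⟨exists_isRightRestrictionMeasure_lt_five_eighths_of_sleKappaRho h84,
    SLEKappaRho.one_half_lt_measure_I_notMem_fill_of_fill_of_lt_five_eighths h84⟩

/-! ### Discharge recipes over the remaining deep leaves -/

/-- **The asymmetry sentence from the one-sided restriction martingale of Lemmas 8.9–8.10 and
ANY two-sided `P_1`**: the martingale gives Thm. 8.4
(`SLEKappaRho.isRightRestrictionMeasure_fill_of_martingale`), `P_1` gives the Cor. 8.6 input
(`exists_isRightRestrictionMeasure_lt_five_eighths_of_exists_one`: all `P⁺_β` as left-filled
Poissonian clouds of hung `P_1`-samples, the positivity `P⁺_β{i ∈ K} > 0`, and [Law05]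
Cor. 9.11 with `P⁺_{5/8}{i ∉ K} = 1/2`).
[cite: LawlerSchrammWerner2003Restriction, proof of Cor. 8.6 (p. 38) with Thm. 8.4 (p. 37); Lawler2005, Cor. 9.11 (p. 219) with Prop. 9.13 (p. 220)] -/
theorem SLEKappaRho.one_half_lt_measure_I_notMem_fill_of_martingale_of_exists_one
    (hM : SLEKappaRho.exists_isOneSidedMartingale)
    (h1 : ∃ P : Measure RestrictionConfig, IsRestrictionMeasure 1 P) :
    SLEKappaRho.one_half_lt_measure_I_notMem_fill :=
  SLEKappaRho.one_half_lt_measure_I_notMem_fill_of_fill_of_lt_five_eighths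
    (SLEKappaRho.isRightRestrictionMeasure_fill_of_martingale hM)
    (exists_isRightRestrictionMeasure_lt_five_eighths_of_exists_one h1)

/-- **The asymmetry sentence from the martingale of Lemmas 8.9–8.10 and [LSW] Prop. 4.1** in the
hypothesis form of `ChordalPathFill`: some probability space carries a random path which is
almost surely a path from `0` to `∞` in `ℍ`, with a.e.-measurable marginals, avoiding each
`A ∈ 𝒬*` with probability `Φ'_A(0)` (in [LSW] the Brownian excursion); its filling has law `P_1`
(`exists_isRestrictionMeasure_of_chordalPath`).
[cite: LawlerSchrammWerner2003Restriction, proof of Cor. 8.6 (p. 38) with Thm. 8.4 (p. 37) and Prop. 4.1 (p. 16)] -/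
theorem SLEKappaRho.one_half_lt_measure_I_notMem_fill_of_martingale_of_chordalPath
    (hM : SLEKappaRho.exists_isOneSidedMartingale)
    {Ω' : Type*} [MeasurableSpace Ω'] {ℙ : Measure Ω'} [IsProbabilityMeasure ℙ]
    {B : Ω' → ℝ≥0 → ℂ} (hpath : ∀ᵐ ω ∂ℙ, IsChordalPath (B ω))
    (hmk : ∀ q : ℚ, AEMeasurable (fun ω ↦ B ω (Real.toNNReal q)) ℙ)
    (h41 : ∀ {A : Set ℂ}, IsStarHull A →
      ∀ {Φ : ConformalEquiv (upperHalfPlaneSet \ A) upperHalfPlaneSet}, IsRestrictionMap A Φ →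
        ∀ {d : ℝ}, HasRestrictionDeriv A Φ d →
          ℙ {ω | Disjoint (range (B ω)) A} = ENNReal.ofReal d) :
    SLEKappaRho.one_half_lt_measure_I_notMem_fill :=
  SLEKappaRho.one_half_lt_measure_I_notMem_fill_of_martingale_of_exists_one hM
    (exists_isRestrictionMeasure_of_chordalPath hpath hmk (α := 1) fun hA _ hΦ _ hd ↦ by
      rw [Real.rpow_one]; exact h41 hA hΦ hd)

/-- **The asymmetry sentence from FOUR named leaves**: the martingale of Lemmas 8.9–8.10 and the
three existence-only §7 leaves (a Brownian bubble measure, `Ξ(κ) ∈ Ω` a.s., Theorem 6.5), which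
give `P_1` as the law of `Ξ(2)` (`exists_isRestrictionMeasure_one_of_three_leaves`). Its
discharge `SLEKappaRho.one_half_lt_measure_I_notMem_fill_holds` is this theorem applied to the
four `_holds`, once they exist.
[cite: LawlerSchrammWerner2003Restriction, proof of Cor. 8.6 (p. 38) with Thm. 8.4 (p. 37) and Thm. 7.3 (p. 29)] -/
theorem SLEKappaRho.one_half_lt_measure_I_notMem_fill_of_four_leaves
    (hM : SLEKappaRho.exists_isOneSidedMartingale) (hμex : exists_isBrownianBubbleMeasure)
    (hcfg : SLEBubbles.ae_mem_restrictionConfigs)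
    (h65 : SLEBubbles.lintegral_poissonAvoidance_eq_rpow) :
    SLEKappaRho.one_half_lt_measure_I_notMem_fill :=
  SLEKappaRho.one_half_lt_measure_I_notMem_fill_of_martingale_of_exists_one hM
    (exists_isRestrictionMeasure_one_of_three_leaves hμex hcfg h65)

end Literature.Probability.RandomPlanarGeometry

end
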